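import Mathlib
import HarnessLib
import Summits.NavierStokesRegularity.NavierStokesRegularity.Theorems.UnthreadedDoorCellFluxNetFluxLeClusterFlux
import Summits.NavierStokesRegularity.NavierStokesRegularity.Theorems.UnthreadedDoorNetFluxStratumLiouville
import Summits.NavierStokesRegularity.NavierStokesRegularity.Theorems.UnthreadedDoorNetFluxOneSidedLawPointwise

/-!
# Route `UnthreadedDoor`, crux `PoloidalLiouville` (stmt-NavierStokesRegularity-1222), WALL W1 — crux idea «cell-flux» (ns-idea-14): Σ-4 CORE
# `cellTameAnalytic_of_decayIntegrable` — Σ-1 + (Σ-3 with the integrability of the cluster flux exported) ⇒ K3^Σ (analytic form)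

ns-qj-p1 g7's two typing notes on Σ-4 `stub_cellTameAnalytic_of_decay` (2026-08-29, custodian GO 13:22:35Z): (1) the rule of Σ-1 is window-dependent,
so the HH-5 tail must run on the rule-independent minorant `netFlux ≤ clusterFlux` (`netFlux_le_clusterFlux`, p722300); (2) the comparison of
integrals needs the cluster flux INTEGRABLE on `(0,R)`, which Σ-3 `ClusterFluxWindowDecayOffNull` does not export as typed.  This file proves the Σ-4
CORE with hypothesis (2) made explicit INSIDE the decay hypothesis (Σ-3's body VERBATIM with the single conjunct `IntegrableOn … (Ioo 0 R)` added to its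
conclusion — a hypothesis of this theorem, not a new statement of the line): then `CellTameAnalyticScalarLiouvilleTypeI` follows from
`HeadClusterRule` by HH-5 (`NetFlux.scalarLiouvilleTypeIOn_of_netFluxWindowDecayOn`, p678536) applied to the stratum
`cellPred N₀ D ∧ (analytic slab data)`: head potential `NetFlux.exists_headPotential` (p673116) + `cross_sub_smul_eq_zero_of_head` (p672773), the
rule from Σ-1, the decay from the hypothesis, `∫₀ᴿ netFlux ≤ ∫₀ᴿ clusterFlux` (`integral_mono_of_nonneg`), then ARM A's p660934 tail inside HH-5.
`ClusterFluxZero` (Σ-0c) is not used.  When the custodian re-types Σ-3 with the integrability conjunct (repair (α)), the registered Σ-4 closes by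
`fun h1 h3' _ => cellTameAnalytic_of_decayIntegrable h1 h3'`.
HONEST LABEL: support reduction; `PoloidalLiouville` (1222), W1 and the summit stay OPEN; NO Navier–Stokes regularity statement is proved.
`--supports stmt-NavierStokesRegularity-1222 --as helper`.  [folklore]
-/

noncomputable section

-- the summit and its single sub-problem share the name (CONVENTIONS §1)
set_option linter.dupNamespace false

open Set Function Filter Topology InnerProductSpace Metric MeasureTheory
open scoped RealInnerProductSpace

namespace Summit.NavierStokesRegularity.NavierStokesRegularity.Theorems.PoloidalLiouville.CellFlux

open Literature.Analysis Literature.Analysis.FluidPDE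
open Summit.NavierStokesRegularity.NavierStokesRegularity.Theorems.PoloidalLiouville.NetFlux
  (E3 sphSup sphInf sphOsc netFlux CurledLaw exists_headPotential cross_sub_smul_eq_zero_of_head scalarLiouvilleTypeIOn_of_netFluxWindowDecayOn)

/-- **Σ-4 CORE.**  `HeadClusterRule` and the window decay of the cumulative cluster flux WITH ITS INTEGRABILITY (Σ-3's body verbatim plus the
conjunct `IntegrableOn (fun r => clusterFlux (T t) r (𝒞 t r)) (Ioo 0 R)`) imply `CellTameAnalyticScalarLiouvilleTypeI`. [folklore] -/
theorem cellTameAnalytic_of_decayIntegrable (h1 : HeadClusterRule)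
    (h3 : ∀ (N₀ : ℕ) (D : Set ℝ), IsClosed D → volume D = 0 → ∀ C : ℝ, 0 ≤ C → ∃ lam > (0 : ℝ), ∃ A : ℝ,
      ∀ (v : ℝ → E3 → E3) (x₀ : E3) (T P : ℝ → E3 → ℝ) (C₁ t₀ : ℝ), t₀ < 0 →
      ContDiffOn ℝ (⊤ : ℕ∞) (uncurry v) (Ioo t₀ 0 ×ˢ univ) →
      ContDiffOn ℝ (⊤ : ℕ∞) (uncurry T) (Ioo t₀ 0 ×ˢ ({x₀}ᶜ : Set E3)) →
      (∀ t ∈ Ioo t₀ 0, ContDiffOn ℝ 1 (P t) ({x₀}ᶜ : Set E3)) →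
      (∀ t ∈ Ioo t₀ 0, ∀ x, ‖v t x‖ ≤ C / Real.sqrt (-t)) →
      (∀ t ∈ Ioo t₀ 0, ∀ x, ‖curl (v t) x‖ ≤ C₁ / (-t)) →
      (∀ t ∈ Ioo t₀ 0, ∀ x, x ≠ x₀ →
          cross (gradient (P t) x - (inner ℝ (v t x) (x - x₀)) • gradient (T t) x) (x - x₀) = 0) →
      (∀ t ∈ Ioo t₀ 0, ∀ x, curl (v t) x = cross (gradient (T t) x) (x - x₀)) →
      CurledLaw v x₀ T (Ioo t₀ 0) →
      (∀ t ∈ Ioo t₀ 0, cellPred N₀ D v x₀ T t) →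
      ∀ 𝒞 : ℝ → ℝ → Set (Set E3), AdmissibleRule x₀ T P (fun t => C / Real.sqrt (-t)) t₀ 𝒞 →
      ∀ t₁ t R : ℝ, t₀ < t₁ → t₁ ≤ t → t < 0 → 0 < R →
        IntegrableOn (fun r => clusterFlux (T t) r (𝒞 t r)) (Ioo 0 R) ∧
        ∫ r in Ioo 0 R, clusterFlux (T t) r (𝒞 t r)
          ≤ A * (N₀ : ℝ) * C₁ * (1 + R / Real.sqrt (-t)) ^ 3 * (t / t₁) ^ lam) :
    CellTameAnalyticScalarLiouvilleTypeI := by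
  intro N₀ D hD hD0 v x₀ T hC hB hmeas hsv hsT hTb hrep hE hvan hTan hcell
  -- the stratum: cell data at every time AND the (time-independent) analytic slab data
  set S : (ℝ → E3 → E3) → E3 → (ℝ → E3 → ℝ) → ℝ → Prop := fun v x₀ T t =>
    cellPred N₀ D v x₀ T t ∧ AnalyticOnNhd ℝ (uncurry v) (Iio (0 : ℝ) ×ˢ (univ : Set E3)) ∧
      AnalyticOnNhd ℝ (uncurry T) (Iio (0 : ℝ) ×ˢ ({x₀}ᶜ : Set E3)) with hSdef
  refine scalarLiouvilleTypeIOn_of_netFluxWindowDecayOn S ?_ v x₀ T hC hB hmeas hsv hsT hTb hrep hE (fun t ht => ⟨hcell t ht, hvan, hTan⟩)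
  -- ### the net-flux window decay on the stratum
  intro C hC0
  obtain ⟨lam, hlam, A, hA⟩ := h3 N₀ D hD hD0 C hC0
  refine ⟨lam, hlam, A * N₀, ?_⟩
  intro v x₀ T C₁ t₀ ht₀ hv hT hvC hω hlink hEw hS' t₁ t R ht₀₁ ht₁ ht hR
  have htw : t ∈ Ioo t₀ 0 := ⟨by linarith, ht⟩
  obtain ⟨-, hvan', hTan'⟩ := hS' t htw
  have hvanw : AnalyticOnNhd ℝ (uncurry v) (Ioo t₀ 0 ×ˢ (univ : Set E3)) :=
    hvan'.mono (prod_mono Ioo_subset_Iio_self le_rfl)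
  have hTanw : AnalyticOnNhd ℝ (uncurry T) (Ioo t₀ 0 ×ˢ ({x₀}ᶜ : Set E3)) :=
    hTan'.mono (prod_mono Ioo_subset_Iio_self le_rfl)
  -- head potential on the window and the tangential head relation
  obtain ⟨P, hP, hhead⟩ := exists_headPotential (v := v) (T := T) (x₀ := x₀) (t₀ := t₀) hv hT hEw
  have hheadx : ∀ s ∈ Ioo t₀ 0, ∀ x, x ≠ x₀ →
      cross (gradient (P s) x - (inner ℝ (v s x) (x - x₀)) • gradient (T s) x) (x - x₀) = 0 :=
    fun s hs x hx => cross_sub_smul_eq_zero_of_head (hhead s hs x hx)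
  -- the rule of Σ-1 on this window
  obtain ⟨𝒞, h𝒞⟩ := h1 N₀ D v x₀ T P (fun s => C / Real.sqrt (-s)) t₀ hv hT hP hvC hheadx hlink hEw hvanw hTanw
    (fun s hs => (hS' s hs).1)
  -- decay with integrability
  obtain ⟨hint, hdec⟩ := hA v x₀ T P C₁ t₀ ht₀ hv hT hP hvC hω hheadx hlink hEw (fun s hs => (hS' s hs).1) 𝒞 h𝒞
    t₁ t R ht₀₁ ht₁ ht hR
  -- `T t` is `C¹` off the centre
  have hTt : ContDiffOn ℝ 1 (T t) ({x₀}ᶜ : Set E3) := by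
    have h1' : ContDiffOn ℝ (⊤ : ℕ∞) (T t) ({x₀}ᶜ : Set E3) :=
      hT.comp (contDiffOn_const.prodMk contDiffOn_id) fun y hy => mk_mem_prod htw hy
    exact h1'.of_le (WithTop.coe_le_coe.2 le_top)
  -- pointwise comparison `netFlux ≤ clusterFlux` and nonnegativity
  have hsph : ∀ {r : ℝ}, 0 < r → Metric.sphere x₀ r ⊆ ({x₀}ᶜ : Set E3) := fun hr z hz => ne_of_mem_sphere hz hr.ne'
  have hnn : ∀ r, 0 < r → 0 ≤ netFlux (T t) x₀ r := by
    intro r hr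
    have hfc : ContinuousOn (T t) (Metric.sphere x₀ r) := hTt.continuousOn.mono (hsph hr)
    have hcpt : IsCompact (T t '' Metric.sphere x₀ r) := (isCompact_sphere x₀ r).image_of_continuousOn hfc
    obtain ⟨y, hy⟩ := (NormedSpace.sphere_nonempty (x := x₀)).2 hr.le
    have h1' : T t y ≤ sSup (T t '' Metric.sphere x₀ r) := le_csSup hcpt.bddAbove ⟨y, hy, rfl⟩
    have h2' : sInf (T t '' Metric.sphere x₀ r) ≤ T t y := csInf_le hcpt.bddBelow ⟨y, hy, rfl⟩
    unfold netFlux sphOsc sphSup sphInf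
    exact mul_nonneg hr.le (by linarith)
  have hle : ∀ r ∈ Ioo 0 R, netFlux (T t) x₀ r ≤ clusterFlux (T t) r (𝒞 t r) := fun r hr =>
    netFlux_le_clusterFlux hr.1 hTt (h𝒞.1 t htw r hr.1)
  have hcmp : ∫ r in Ioo 0 R, netFlux (T t) x₀ r ≤ ∫ r in Ioo 0 R, clusterFlux (T t) r (𝒞 t r) := by
    refine integral_mono_of_nonneg ?_ hint ?_
    · exact (ae_restrict_iff' measurableSet_Ioo).2 (Eventually.of_forall fun r hr => hnn r hr.1)
    · exact (ae_restrict_iff' measurableSet_Ioo).2 (Eventually.of_forall fun r hr => hle r hr)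
  calc ∫ r in Ioo 0 R, netFlux (T t) x₀ r ≤ ∫ r in Ioo 0 R, clusterFlux (T t) r (𝒞 t r) := hcmp
    _ ≤ A * (N₀ : ℝ) * C₁ * (1 + R / Real.sqrt (-t)) ^ 3 * (t / t₁) ^ lam := hdec
    _ = A * N₀ * C₁ * (1 + R / Real.sqrt (-t)) ^ 3 * (t / t₁) ^ lam := by ring

end Summit.NavierStokesRegularity.NavierStokesRegularity.Theorems.PoloidalLiouville.CellFlux

end
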